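import Mathlib

/-!
# Tier7/Line3/WeightProjector — the isotypic projector of a character, and «the A-side loses nothing» (seat t7-L1-p4)

LINE 3 (t7-plan-3), version (ii), memo v13 §2g property (3): «the `A`-period functional on a `π`-copy factors
through the `μ_{A,v}`-weight line, which IS the `u_{A,v}`-line, so the one-vector projection loses nothing on the
`A`-side». THIS FILE proves the abstract statement (Mathlib only): `T` a compact group with a left-invariant
probability measure `μ` (the torus `T_A(F_v)`), `τ : T →* (V →L[ℂ] V)` a continuous representation, `χ : T →* ℂ` a
continuous unitary character (`‖χ t‖ = 1`), and the ISOTYPIC PROJECTOR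

  `weightProj μ τ χ v := ∫ conj (χ t) • τ t v dμ(t)`.

* `weightProj_of_isWeightVector`: `weightProj v = v` for a `χ`-weight vector (`τ t v = χ t • v`);
* `isWeightVector_weightProj`: `weightProj v` is a `χ`-weight vector (left invariance); hence `weightProj` is
  idempotent (`weightProj_weightProj`) — the projection onto the `χ`-weight space;
* `apply_weightProj_of_equivariant`: a `χ`-EQUIVARIANT functional `P` (`P (τ t v) = χ t * P v`) satisfies
  `P (weightProj v) = P v` — `P` factors through the projector;
* `weightProj_eq_inner_smul` / `apply_eq_inner_mul_of_equivariant`: if `τ` is unitary and the `χ`-weight space is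
  the line `ℂ u` with `‖u‖ = 1` (multiplicity one), then `weightProj v = ⟪u, v⟫ • u` and every `χ`-equivariant
  functional is `P v = ⟪u, v⟫ * P u` — it factors through the rank-one projector onto `u`
  (`SchurProjector.integral_inner_smul_apply_self`'s `v ↦ ⟪u, v⟫ • u`): the `A`-side loses nothing.

Nothing here is about an adelic group, a period or (N); the identification of `T_A(F_v)`, `μ_{A,v}`, `u_{A,v}` and
the period functional with these objects is the dictionary (in words). No sorry;
axioms ⊆ {propext, Classical.choice, Quot.sound}.
-/

namespace Summit.Ventures.HodgeRepro2.Tier7.Line3.WeightProjector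

open MeasureTheory
open scoped InnerProductSpace

variable {T : Type*} [Group T]
variable {V : Type*} [NormedAddCommGroup V] [InnerProductSpace ℂ V]

/-- `τ (a * b) v = τ a (τ b v)`. -/
theorem apply_mul_apply (τ : T →* (V →L[ℂ] V)) (a b : T) (v : V) : τ (a * b) v = τ a (τ b v) := by
  rw [map_mul, ContinuousLinearMap.mul_def, ContinuousLinearMap.comp_apply]

/-- a unitary character: `‖χ t‖ = 1`, i.e. `conj (χ t) * χ t = 1`. -/
def IsUnitaryChar (χ : T →* ℂ) : Prop := ∀ t, ‖χ t‖ = 1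

/-- `conj (χ t) * χ t = 1` for a unitary character. -/
theorem IsUnitaryChar.conj_mul {χ : T →* ℂ} (hχ : IsUnitaryChar χ) (t : T) :
    (starRingEnd ℂ) (χ t) * χ t = 1 := by
  rw [Complex.conj_mul', hχ t]
  norm_num

/-- `conj (χ t⁻¹) = χ t` for a unitary character. -/
theorem IsUnitaryChar.conj_inv {χ : T →* ℂ} (hχ : IsUnitaryChar χ) (t : T) :
    (starRingEnd ℂ) (χ t⁻¹) = χ t := by
  have h1 : χ t⁻¹ * χ t = 1 := by rw [← map_mul, inv_mul_cancel, map_one]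
  have h1' : χ t⁻¹ = (χ t)⁻¹ := eq_inv_of_mul_eq_one_left h1
  have h2' : (starRingEnd ℂ) (χ t) = (χ t)⁻¹ := eq_inv_of_mul_eq_one_left (hχ.conj_mul t)
  rw [h1', map_inv₀, h2', inv_inv]

/-- a `χ`-weight vector: `τ t v = χ t • v` for every `t`. -/
def IsWeightVector (τ : T →* (V →L[ℂ] V)) (χ : T →* ℂ) (v : V) : Prop := ∀ t, τ t v = χ t • v

/-- the isotypic projector of the character `χ`: `v ↦ ∫ conj (χ t) • τ t v dμ`. -/
noncomputable def weightProj [MeasurableSpace T] (μ : Measure T) (τ : T →* (V →L[ℂ] V)) (χ : T →* ℂ) (v : V) :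
    V := ∫ t, (starRingEnd ℂ) (χ t) • τ t v ∂μ

section Integrability

/-- the integrand of the projector is continuous. -/
theorem continuous_integrand [TopologicalSpace T] (τ : T →* (V →L[ℂ] V)) (χ : T →* ℂ) (hτ : Continuous τ)
    (hχ : Continuous χ) (v : V) : Continuous fun t => (starRingEnd ℂ) (χ t) • τ t v :=
  (Complex.continuous_conj.comp hχ).smul (hτ.clm_apply continuous_const)

/-- the integrand of the projector is integrable. -/
theorem integrable_integrand [TopologicalSpace T] [CompactSpace T] [MeasurableSpace T] [BorelSpace T]
    (μ : Measure T) [IsFiniteMeasure μ] (τ : T →* (V →L[ℂ] V)) (χ : T →* ℂ)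
    (hτ : Continuous τ) (hχ : Continuous χ) (v : V) :
    Integrable (fun t => (starRingEnd ℂ) (χ t) • τ t v) μ :=
  (continuous_integrand τ χ hτ hχ v).integrable_of_hasCompactSupport (HasCompactSupport.of_compactSpace _)

/-- **a weight vector is fixed by its projector**: `weightProj v = v` for a `χ`-weight vector. -/
theorem weightProj_of_isWeightVector [MeasurableSpace T] (μ : Measure T) [IsProbabilityMeasure μ]
    [CompleteSpace V] (τ : T →* (V →L[ℂ] V))
    (χ : T →* ℂ) (hχu : IsUnitaryChar χ) {v : V} (hv : IsWeightVector τ χ v) : weightProj μ τ χ v = v := by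
  unfold weightProj
  have e : (fun t => (starRingEnd ℂ) (χ t) • τ t v) = fun _ => v := by
    funext t
    rw [hv t, smul_smul, hχu.conj_mul, one_smul]
  rw [e, integral_const]
  simp

/-- **the projector lands in the weight space**: `weightProj v` is a `χ`-weight vector (left invariance). -/
theorem isWeightVector_weightProj [TopologicalSpace T] [IsTopologicalGroup T] [CompactSpace T]
    [MeasurableSpace T] [BorelSpace T] (μ : Measure T) [IsFiniteMeasure μ] [μ.IsMulLeftInvariant]
    [CompleteSpace V] (τ : T →* (V →L[ℂ] V)) (χ : T →* ℂ) (hτ : Continuous τ) (hχ : Continuous χ)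
    (hχu : IsUnitaryChar χ) (v : V) : IsWeightVector τ χ (weightProj μ τ χ v) := by
  intro s
  unfold weightProj
  rw [← (τ s).integral_comp_comm (integrable_integrand μ τ χ hτ hχ v), ← integral_smul]
  -- substitute `t ↦ s⁻¹ * t`
  have e : (fun t => τ s ((starRingEnd ℂ) (χ t) • τ t v)) =
      fun t => χ s • ((starRingEnd ℂ) (χ (s * t)) • τ (s * t) v) := by
    funext t
    rw [map_smul, ← apply_mul_apply τ s t v, smul_smul, map_mul χ s t, map_mul (starRingEnd ℂ) (χ s) (χ t)]
    congr 1
    rw [← mul_assoc, mul_comm (χ s), hχu.conj_mul, one_mul]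
  rw [e]
  exact integral_mul_left_eq_self (fun t' => χ s • ((starRingEnd ℂ) (χ t') • τ t' v)) s

/-- **idempotence**: `weightProj (weightProj v) = weightProj v`. -/
theorem weightProj_weightProj [TopologicalSpace T] [IsTopologicalGroup T] [CompactSpace T]
    [MeasurableSpace T] [BorelSpace T] (μ : Measure T) [IsProbabilityMeasure μ] [μ.IsMulLeftInvariant]
    [CompleteSpace V] (τ : T →* (V →L[ℂ] V)) (χ : T →* ℂ) (hτ : Continuous τ) (hχ : Continuous χ)
    (hχu : IsUnitaryChar χ) (v : V) : weightProj μ τ χ (weightProj μ τ χ v) = weightProj μ τ χ v :=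
  weightProj_of_isWeightVector μ τ χ hχu (isWeightVector_weightProj μ τ χ hτ hχ hχu v)

/-- **a `χ`-equivariant functional factors through the projector**: `P (weightProj v) = P v`. -/
theorem apply_weightProj_of_equivariant [TopologicalSpace T] [CompactSpace T] [MeasurableSpace T]
    [BorelSpace T] (μ : Measure T) [IsProbabilityMeasure μ] [CompleteSpace V] (τ : T →* (V →L[ℂ] V))
    (χ : T →* ℂ) (hτ : Continuous τ) (hχ : Continuous χ) (hχu : IsUnitaryChar χ) (P : V →L[ℂ] ℂ)
    (hP : ∀ t v, P (τ t v) = χ t * P v) (v : V) : P (weightProj μ τ χ v) = P v := by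
  unfold weightProj
  rw [← P.integral_comp_comm (integrable_integrand μ τ χ hτ hχ v)]
  have e : (fun t => P ((starRingEnd ℂ) (χ t) • τ t v)) = fun _ => P v := by
    funext t
    rw [map_smul, hP, smul_eq_mul, ← mul_assoc, hχu.conj_mul, one_mul]
  rw [e, integral_const]
  simp

/-- a unitary representation: every `τ t` preserves the inner product. -/
def IsUnitaryRep (τ : T →* (V →L[ℂ] V)) : Prop := ∀ t x y, ⟪τ t x, τ t y⟫_ℂ = ⟪x, y⟫_ℂ

/-- `⟪u, weightProj v⟫ = ⟪u, v⟫` for a `χ`-weight vector `u` (unitary `τ`, unitary `χ`). -/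
theorem inner_weightProj [TopologicalSpace T] [CompactSpace T] [MeasurableSpace T] [BorelSpace T]
    (μ : Measure T) [IsProbabilityMeasure μ] [CompleteSpace V] (τ : T →* (V →L[ℂ] V))
    (χ : T →* ℂ) (hτ : Continuous τ) (hτu : IsUnitaryRep τ) (hχ : Continuous χ) (hχu : IsUnitaryChar χ)
    {u : V} (hu : IsWeightVector τ χ u) (v : V) : ⟪u, weightProj μ τ χ v⟫_ℂ = ⟪u, v⟫_ℂ := by
  unfold weightProj
  rw [← integral_inner (integrable_integrand μ τ χ hτ hχ v)]
  have e : (fun t => ⟪u, (starRingEnd ℂ) (χ t) • τ t v⟫_ℂ) = fun _ => ⟪u, v⟫_ℂ := by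
    funext t
    have h1 : ⟪u, τ t v⟫_ℂ = ⟪τ t⁻¹ u, v⟫_ℂ := by
      have h2 : τ t⁻¹ (τ t v) = v := by
        rw [← apply_mul_apply, inv_mul_cancel, map_one, one_apply_eq_self]
      calc ⟪u, τ t v⟫_ℂ = ⟪τ t⁻¹ u, τ t⁻¹ (τ t v)⟫_ℂ := (hτu t⁻¹ u (τ t v)).symm
        _ = ⟪τ t⁻¹ u, v⟫_ℂ := by rw [h2]
    rw [inner_smul_right, h1, hu t⁻¹, inner_smul_left, hχu.conj_inv, ← mul_assoc, hχu.conj_mul, one_mul]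
  rw [e, integral_const]
  simp

/-- **multiplicity one**: if the `χ`-weight space is the line `ℂ u` (`‖u‖ = 1`), the projector is the rank-one
projector `v ↦ ⟪u, v⟫ • u`. -/
theorem weightProj_eq_inner_smul [TopologicalSpace T] [IsTopologicalGroup T] [CompactSpace T]
    [MeasurableSpace T] [BorelSpace T] (μ : Measure T) [IsProbabilityMeasure μ] [μ.IsMulLeftInvariant]
    [CompleteSpace V] (τ : T →* (V →L[ℂ] V)) (χ : T →* ℂ) (hτ : Continuous τ) (hτu : IsUnitaryRep τ)
    (hχ : Continuous χ) (hχu : IsUnitaryChar χ) {u : V} (hu : IsWeightVector τ χ u) (hu1 : ‖u‖ = 1)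
    (hmult : ∀ w, IsWeightVector τ χ w → ∃ c : ℂ, w = c • u) (v : V) :
    weightProj μ τ χ v = ⟪u, v⟫_ℂ • u := by
  obtain ⟨c, hc⟩ := hmult _ (isWeightVector_weightProj μ τ χ hτ hχ hχu v)
  have h := inner_weightProj μ τ χ hτ hτu hχ hχu hu v
  rw [hc, inner_smul_right, inner_self_eq_norm_sq_to_K, hu1] at h
  have h' : c = ⟪u, v⟫_ℂ := by simpa using h
  rw [hc, h']

/-- **the `A`-side loses nothing**: with multiplicity one, every `χ`-equivariant functional factors through the
rank-one projector onto `u`: `P v = ⟪u, v⟫ * P u`. -/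
theorem apply_eq_inner_mul_of_equivariant [TopologicalSpace T] [IsTopologicalGroup T] [CompactSpace T]
    [MeasurableSpace T] [BorelSpace T] (μ : Measure T) [IsProbabilityMeasure μ] [μ.IsMulLeftInvariant]
    [CompleteSpace V] (τ : T →* (V →L[ℂ] V)) (χ : T →* ℂ) (hτ : Continuous τ) (hτu : IsUnitaryRep τ)
    (hχ : Continuous χ) (hχu : IsUnitaryChar χ) {u : V} (hu : IsWeightVector τ χ u) (hu1 : ‖u‖ = 1)
    (hmult : ∀ w, IsWeightVector τ χ w → ∃ c : ℂ, w = c • u) (P : V →L[ℂ] ℂ)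
    (hP : ∀ t v, P (τ t v) = χ t * P v) (v : V) : P v = ⟪u, v⟫_ℂ * P u := by
  rw [← apply_weightProj_of_equivariant μ τ χ hτ hχ hχu P hP v,
    weightProj_eq_inner_smul μ τ χ hτ hτu hχ hχu hu hu1 hmult v, map_smul, smul_eq_mul]

end Integrability

end Summit.Ventures.HodgeRepro2.Tier7.Line3.WeightProjector
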